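import Mathlib
import Summits.NavierStokesRegularity.NavierStokesRegularity.Theorems.TaoLadderRungThreeGappedFrontRobustSlackRecursion
import HarnessLib

/-!
# `GappedFrontRobust`, the (step) clause: SLACK WEIGHTS BOUNDED UNIFORMLY IN THE NUMBER OF PAST EPOCHS
  for the two-piece envelope of the K_B₂ assembly (helper for item stmt-NavierStokesRegularity-22114
  `GappedFrontRobustV2`)

HONEST FRAMING: elementary real-number bookkeeping about the cell's slack envelope
`TaoCascade.slackWeight` (Tao 2016 §6.4 Lemma 6.7 / (4.10)); nothing is asserted about any table or flow;
nothing here concerns the Navier–Stokes equations.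

The (step) clause hands the prover an accumulated slack `B₀ ≤ η · slackWeight ε₀ θ c env L k` with an
ARBITRARY number `L` of past epochs, so every budget of the assembly needs a bound of the slack weight that
is uniform in `L`; by `…SlackRecursion.slackWeight_le_of_supersolution` it suffices to exhibit a
nonnegative supersolution of the one-step recursion. For the assembly's envelope (`q = 1+ε₀`)
`env j = E q^{2(k₂−j)}` (`j < k₂`), `env j = K r²/w(j−1)²` (`j ≥ k₂`) an explicit supersolution exists under
(T1) from `k₁ ≤ k₂ − 1`, `k₂ ≥ 3`, `0 ≤ θ ≤ 1/2`: this gives the TAIL bound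
`slackWeight L k ≤ 2 c q^{5/2+θ} K · q^{2k} r²/(w k)²` for `k ≥ k₂ − 1` (the shape consumed by the tail zone)
and the LOW bound `slackWeight L k ≤ Csw · q^{−(1/2+θ) k}` for `k ≤ k₂ − 1` (`two_piece_slackWeight_le`), and
the envelope satisfies the slack-decay criterion (`two_piece_slackDecay`).
-/

noncomputable section

-- the sub-problem namespace `Summit.NavierStokesRegularity.NavierStokesRegularity` repeats the summit name by design (D-0017)
set_option linter.dupNamespace false

namespace Summit.NavierStokesRegularity.NavierStokesRegularity.Theorems

open Set Literature.Analysis.FluidPDE Literature.Analysis.FluidPDE.TaoCascade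

namespace GappedFrontRobust

/-! ### The two-piece envelope of the K_B₂ assembly -/

section TwoPiece

variable {ε₀ θ c r E K : ℝ} {w env : ℤ → ℝ} {k₁ k₂ : ℤ}

/-- The two-piece envelope is nonnegative (`E, K ≥ 0`, `q > 0`).
[cite: Tao2016AveragedNS, §6.2 Prop. 6.3 (ix) (shape of an epoch envelope); cell vocabulary] -/
theorem two_piece_env_nonneg (hε : 0 < 1 + ε₀) (hE : 0 ≤ E) (hK : 0 ≤ K)
    (hlo : ∀ j : ℤ, j < k₂ → env j = E * (1 + ε₀) ^ ((2 : ℝ) * (k₂ - j)))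
    (hhi : ∀ j : ℤ, k₂ ≤ j → env j = K * r ^ 2 / w (j - 1) ^ 2) (j : ℤ) : 0 ≤ env j := by
  by_cases hj : j < k₂
  · rw [hlo j hj]; exact mul_nonneg hE (Real.rpow_pos_of_pos hε _).le
  · rw [hhi j (not_lt.mp hj)]; positivity

/-- **Tail and low slack bounds for the two-piece envelope, via one supersolution.** Under (T1)
`2 q^k w k ≤ w (k+1)` for `k ≥ k₁` (`q = 1+ε₀ > 1`, `w > 0`), `k₁ + 1 ≤ k₂`, `3 ≤ k₂`, `0 ≤ θ ≤ 1/2`,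
`c, E, K ≥ 0`, the function `B k = 2 c q^{2k} q^{5/2+θ} K r²/(w k)²` (`k ≥ k₂ − 1`),
`B k = c E q^{2k₂} (x^{k₂−k} − x)/(x − 1) + x^{k₂−1−k} B (k₂−1)` (`k < k₂ − 1`, `x = q^{1/2+θ}`) is a
nonnegative supersolution, whence for all `L`: (tail) `slackWeight L k ≤ 2 c q^{5/2+θ} K q^{2k} r²/(w k)²` for
`k ≥ k₂ − 1`, and (low) `slackWeight L k ≤ (c E q^{2k₂} x^{k₂}/(x−1) + x^{k₂−1} B(k₂−1)) · q^{−(1/2+θ)k}`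
for `k ≤ k₂ − 1`. [cite: Tao2016AveragedNS, §6.4 Lemma 6.7 (cumulative energy bound); cell vocabulary] -/
theorem two_piece_slackWeight_le (hε : 0 < ε₀) (hθ : 0 ≤ θ) (hθ' : θ ≤ 1 / 2) (hc : 0 ≤ c)
    (hE : 0 ≤ E) (hK : 0 ≤ K) (hw : ∀ k, 0 < w k)
    (hT1 : ∀ k : ℤ, k₁ ≤ k → 2 * (1 + ε₀) ^ (k : ℝ) * w k ≤ w (k + 1))
    (hk₂ : k₁ + 1 ≤ k₂) (hk₂3 : 3 ≤ k₂)
    (hlo : ∀ j : ℤ, j < k₂ → env j = E * (1 + ε₀) ^ ((2 : ℝ) * (k₂ - j)))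
    (hhi : ∀ j : ℤ, k₂ ≤ j → env j = K * r ^ 2 / w (j - 1) ^ 2) :
    (∀ (L : ℕ) (k : ℤ), k₂ - 1 ≤ k → slackWeight ε₀ θ c env L k ≤
        2 * c * (1 + ε₀) ^ (5 / 2 + θ) * K * ((1 + ε₀) ^ ((2 : ℝ) * k) * r ^ 2 / w k ^ 2)) ∧
    (∀ (L : ℕ) (k : ℤ), k ≤ k₂ - 1 → slackWeight ε₀ θ c env L k ≤
        (c * E * (1 + ε₀) ^ ((2 : ℝ) * k₂) * ((1 + ε₀) ^ (1 / 2 + θ)) ^ (k₂ : ℝ) /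
            ((1 + ε₀) ^ (1 / 2 + θ) - 1) +
          ((1 + ε₀) ^ (1 / 2 + θ)) ^ (((k₂ - 1 : ℤ)) : ℝ) *
            (2 * c * (1 + ε₀) ^ (5 / 2 + θ) * K *
              ((1 + ε₀) ^ ((2 : ℝ) * ((k₂ - 1 : ℤ) : ℝ)) * r ^ 2 / w (k₂ - 1) ^ 2))) *
        (1 + ε₀) ^ (-((1 / 2 + θ) * k))) := by
  have hq : 0 < 1 + ε₀ := by linarith
  have hq1 : 1 < 1 + ε₀ := by linarith
  set q : ℝ := 1 + ε₀ with hqdef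
  set x : ℝ := q ^ (1 / 2 + θ) with hx
  have hx1 : 1 < x := Real.one_lt_rpow hq1 (by linarith)
  have hx0 : 0 < x := by linarith
  have hxm : 0 < x - 1 := by linarith
  have henv0 : ∀ j, 0 ≤ env j := two_piece_env_nonneg hq hE hK hlo hhi
  -- the tail formula and B₁
  set T : ℤ → ℝ := fun k => 2 * c * q ^ (5 / 2 + θ) * K * (q ^ ((2 : ℝ) * k) * r ^ 2 / w k ^ 2) with hT
  have hT0 : ∀ k, 0 ≤ T k := fun k => by
    have := hw k; have := Real.rpow_pos_of_pos hq ((2 : ℝ) * k)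
    have := Real.rpow_pos_of_pos hq (5 / 2 + θ); positivity
  set B₁ : ℝ := T (k₂ - 1) with hB₁
  have hB₁0 : 0 ≤ B₁ := hT0 _
  -- the low formula
  set Lo : ℤ → ℝ := fun k => c * E * q ^ ((2 : ℝ) * k₂) * (x ^ (((k₂ - k : ℤ)) : ℝ) - x) / (x - 1) +
    x ^ (((k₂ - 1 - k : ℤ)) : ℝ) * B₁ with hLo
  set B : ℤ → ℝ := fun k => if k₂ - 1 ≤ k then T k else Lo k with hB
  -- nonnegativity of the low formula for k ≤ k₂ - 1
  have hLo0 : ∀ k : ℤ, k ≤ k₂ - 1 → 0 ≤ Lo k := by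
    intro k hk
    have h1 : x ≤ x ^ (((k₂ - k : ℤ)) : ℝ) := by
      have : (1 : ℝ) ≤ ((k₂ - k : ℤ) : ℝ) := by exact_mod_cast (show (1 : ℤ) ≤ k₂ - k by linarith)
      calc x = x ^ (1 : ℝ) := (Real.rpow_one x).symm
        _ ≤ x ^ (((k₂ - k : ℤ)) : ℝ) := Real.rpow_le_rpow_of_exponent_le hx1.le this
    have h2 : 0 ≤ x ^ (((k₂ - 1 - k : ℤ)) : ℝ) := (Real.rpow_pos_of_pos hx0 _).le
    have h3 : 0 ≤ q ^ ((2 : ℝ) * k₂) := (Real.rpow_pos_of_pos hq _).le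
    simp only [hLo]
    have : 0 ≤ c * E * q ^ ((2 : ℝ) * k₂) * (x ^ (((k₂ - k : ℤ)) : ℝ) - x) / (x - 1) :=
      div_nonneg (by have := mul_nonneg (mul_nonneg hc hE) h3; nlinarith) hxm.le
    positivity
  have hB0 : ∀ k, 0 ≤ B k := fun k => by
    simp only [hB]; split_ifs with hk
    · exact hT0 k
    · exact hLo0 k (by linarith)
  -- the supersolution inequality, tail part: k ≥ k₂ - 1
  have htail : ∀ k : ℤ, k₂ - 1 ≤ k →
      c * q ^ ((2 : ℝ) * k) * (q ^ (5 / 2 + θ) * env (k + 1)) + x * T (k + 1) ≤ T k := by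
    intro k hk
    have hwk := hw k
    have hwk1 := hw (k + 1)
    have hk1 : k₁ ≤ k := by linarith
    have hT1k := hT1 k hk1
    have henv1 : env (k + 1) = K * r ^ 2 / w k ^ 2 := by
      rw [hhi (k + 1) (by linarith)]; ring_nf
    -- first term = T k / 2
    have hfirst : c * q ^ ((2 : ℝ) * k) * (q ^ (5 / 2 + θ) * env (k + 1)) = T k / 2 := by
      rw [henv1]; simp only [hT]; ring
    -- second term ≤ T k / 2 :  x T(k+1) ≤ T k / 2  ⟸  2 x q² w_k² ≤ w(k+1)²
    have hqk : 0 < q ^ (k : ℝ) := Real.rpow_pos_of_pos hq _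
    have hsq : 4 * (q ^ (k : ℝ)) ^ 2 * w k ^ 2 ≤ w (k + 1) ^ 2 := by
      have h0 : 0 ≤ 2 * q ^ (k : ℝ) * w k := by positivity
      nlinarith [pow_le_pow_left₀ h0 hT1k 2]
    -- 2 x q² ≤ 4 q^{2k}: x q² = q^{5/2+θ} ≤ q^{3} and 2 q^3 ≤ 4 q^{2k} for k ≥ 2
    have hk2 : (2 : ℝ) ≤ k := by exact_mod_cast (show (2 : ℤ) ≤ k by linarith)
    have hxq : x * q ^ ((2 : ℝ) * (((k + 1 : ℤ)) : ℝ)) ≤ 2 * (q ^ (k : ℝ)) ^ 2 * q ^ ((2 : ℝ) * k) := by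
      have h1 : x * q ^ ((2 : ℝ) * (((k + 1 : ℤ)) : ℝ)) = q ^ (5 / 2 + θ) * q ^ ((2 : ℝ) * k) := by
        simp only [hx]; rw [← Real.rpow_add hq, ← Real.rpow_add hq]; push_cast; ring_nf
      have h2 : (q ^ (k : ℝ)) ^ 2 = q ^ ((2 : ℝ) * k) := by
        rw [← Real.rpow_natCast, ← Real.rpow_mul hq.le]; ring_nf
      have h3 : q ^ (5 / 2 + θ) ≤ q ^ ((2 : ℝ) * k) := Real.rpow_le_rpow_of_exponent_le hq1.le (by linarith)
      have h4 : 0 ≤ q ^ ((2 : ℝ) * k) := (Real.rpow_pos_of_pos hq _).le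
      rw [h1, h2]; nlinarith
    have hsecond : x * T (k + 1) ≤ T k / 2 := by
      simp only [hT]
      -- x * (2c q^{5/2+θ} K (q^{2(k+1)} r² / w(k+1)²)) ≤ c q^{5/2+θ} K (q^{2k} r²/w_k²)
      have hcK : 0 ≤ c * q ^ (5 / 2 + θ) * K * r ^ 2 := by
        have := Real.rpow_pos_of_pos hq (5 / 2 + θ); positivity
      rw [show x * (2 * c * q ^ (5 / 2 + θ) * K * (q ^ ((2 : ℝ) * (((k + 1 : ℤ)) : ℝ)) * r ^ 2 /
          w (k + 1) ^ 2)) = (c * q ^ (5 / 2 + θ) * K * r ^ 2) *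
          (2 * (x * q ^ ((2 : ℝ) * (((k + 1 : ℤ)) : ℝ))) / w (k + 1) ^ 2) by push_cast; ring]
      rw [show 2 * c * q ^ (5 / 2 + θ) * K * (q ^ ((2 : ℝ) * k) * r ^ 2 / w k ^ 2) / 2 =
          (c * q ^ (5 / 2 + θ) * K * r ^ 2) * (q ^ ((2 : ℝ) * k) / w k ^ 2) by ring]
      refine mul_le_mul_of_nonneg_left ?_ hcK
      rw [div_le_div_iff₀ (pow_pos hwk1 2) (pow_pos hwk 2)]
      have h4 : 0 ≤ q ^ ((2 : ℝ) * k) := (Real.rpow_pos_of_pos hq _).le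
      calc 2 * (x * q ^ ((2 : ℝ) * (((k + 1 : ℤ)) : ℝ))) * w k ^ 2
          ≤ 2 * (2 * (q ^ (k : ℝ)) ^ 2 * q ^ ((2 : ℝ) * k)) * w k ^ 2 := by
            gcongr
        _ = q ^ ((2 : ℝ) * k) * (4 * (q ^ (k : ℝ)) ^ 2 * w k ^ 2) := by ring
        _ ≤ q ^ ((2 : ℝ) * k) * w (k + 1) ^ 2 := mul_le_mul_of_nonneg_left hsq h4
    linarith
  -- the supersolution inequality, low part: k ≤ k₂ - 2 (equality)
  have hlow : ∀ k : ℤ, k ≤ k₂ - 2 →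
      c * q ^ ((2 : ℝ) * k) * (q ^ (5 / 2 + θ) * env (k + 1)) + x * Lo (k + 1) = Lo k := by
    intro k hk
    have henv1 : env (k + 1) = E * q ^ ((2 : ℝ) * (k₂ - (((k + 1 : ℤ)) : ℝ))) := by
      rw [hlo (k + 1) (by linarith)]
    rw [henv1]
    simp only [hLo]
    -- powers of x
    have hx1' : x ^ (((k₂ - (k + 1) : ℤ)) : ℝ) * x = x ^ (((k₂ - k : ℤ)) : ℝ) := by
      rw [← Real.rpow_add_one hx0.ne']; push_cast; ring_nf
    have hx2' : x * x ^ (((k₂ - 1 - (k + 1) : ℤ)) : ℝ) = x ^ (((k₂ - 1 - k : ℤ)) : ℝ) := by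
      rw [mul_comm, ← Real.rpow_add_one hx0.ne']; push_cast; ring_nf
    -- c q^{2k} q^{5/2+θ} E q^{2(k₂-k-1)} = c E q^{2k₂} x
    have hfirst : c * q ^ ((2 : ℝ) * k) * (q ^ (5 / 2 + θ) * (E * q ^ ((2 : ℝ) * (k₂ - (((k + 1 : ℤ)) : ℝ))))) =
        c * E * q ^ ((2 : ℝ) * k₂) * x := by
      simp only [hx]
      have : q ^ ((2 : ℝ) * k) * q ^ (5 / 2 + θ) * q ^ ((2 : ℝ) * (k₂ - (((k + 1 : ℤ)) : ℝ))) =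
          q ^ ((2 : ℝ) * k₂) * q ^ (1 / 2 + θ) := by
        rw [← Real.rpow_add hq, ← Real.rpow_add hq, ← Real.rpow_add hq]; push_cast; ring_nf
      calc _ = c * E * (q ^ ((2 : ℝ) * k) * q ^ (5 / 2 + θ) * q ^ ((2 : ℝ) * (k₂ - (((k + 1 : ℤ)) : ℝ)))) := by
            ring
        _ = _ := by rw [this]; ring
    rw [hfirst]
    have hxx : x ^ (((k₂ - (k + 1) : ℤ)) : ℝ) - x = (x ^ (((k₂ - k : ℤ)) : ℝ) - x * x) / x := by
      rw [← hx1']; field_simp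
    rw [hxx]
    field_simp
    rw [← hx2']
    ring
  -- assemble the supersolution property for B
  have hBsup : ∀ k : ℤ, c * q ^ ((2 : ℝ) * k) * (q ^ (5 / 2 + θ) * env (k + 1)) + x * B (k + 1) ≤ B k := by
    intro k
    by_cases hk : k₂ - 1 ≤ k
    · have h1 : B k = T k := by simp only [hB, hk, if_true]
      have h2 : B (k + 1) = T (k + 1) := by simp only [hB, show k₂ - 1 ≤ k + 1 by linarith, if_true]
      rw [h1, h2]; exact htail k hk
    · push Not at hk
      have h1 : B k = Lo k := by simp only [hB, show ¬ (k₂ - 1 ≤ k) from not_le.mpr hk, if_false]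
      rw [h1]
      by_cases hk' : k = k₂ - 2
      · -- B (k+1) = T (k₂ - 1) = B₁ = Lo (k₂ - 1)
        have h2 : B (k + 1) = T (k + 1) := by
          simp only [hB, show k₂ - 1 ≤ k + 1 by rw [hk']; linarith, if_true]
        have h3 : T (k + 1) = Lo (k + 1) := by
          have hk1 : k + 1 = k₂ - 1 := by rw [hk']; ring
          rw [hk1]
          simp only [hLo, hB₁]
          have : x ^ (((k₂ - (k₂ - 1) : ℤ)) : ℝ) = x := by
            rw [show k₂ - (k₂ - 1) = 1 by ring]; simp
          rw [this, show ((k₂ - 1 - (k₂ - 1) : ℤ) : ℝ) = 0 by push_cast; ring, Real.rpow_zero]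
          simp
        rw [h2, h3, hlow k (by rw [hk'])]
      · have hk2 : k ≤ k₂ - 2 := by omega
        have hk3 : k + 1 < k₂ - 1 := by omega
        have h2 : B (k + 1) = Lo (k + 1) := by
          simp only [hB, show ¬ (k₂ - 1 ≤ k + 1) from not_le.mpr hk3, if_false]
        rw [h2, hlow k hk2]
  have hmain := slackWeight_le_of_supersolution (θ := θ) (c := c) (env := env) (B := B) hq hB0
    (fun k => by simpa only [hx] using hBsup k)
  refine ⟨fun L k hk => ?_, fun L k hk => ?_⟩
  · have := hmain L k
    simp only [hB, hk, if_true, hT] at this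
    exact this
  · have h1 := hmain L k
    -- B k ≤ Csw x^{-k} for k ≤ k₂ - 1
    have hxneg : x ^ (-((1 : ℝ) * k)) = q ^ (-((1 / 2 + θ) * k)) := by
      simp only [hx]; rw [← Real.rpow_mul hq.le]; ring_nf
    have hxk : ∀ a : ℤ, x ^ ((a : ℤ) : ℝ) = x ^ (((a + k : ℤ)) : ℝ) * x ^ (-((1 : ℝ) * k)) := by
      intro a; rw [← Real.rpow_add hx0]; push_cast; ring_nf
    rcases eq_or_lt_of_le hk with rfl | hlt
    · -- k = k₂ - 1 : B = T (k₂-1) = B₁ ≤ x^{k₂-1} B₁ x^{-(k₂-1)} ≤ Csw x^{-k}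
      simp only [hB, le_refl, if_true] at h1
      refine h1.trans ?_
      rw [← hxneg]
      have hA0 : 0 ≤ c * E * q ^ ((2 : ℝ) * k₂) * x ^ (k₂ : ℝ) / (x - 1) := by
        have := Real.rpow_pos_of_pos hq ((2 : ℝ) * k₂); have := Real.rpow_pos_of_pos hx0 (k₂ : ℝ)
        positivity
      have heq : x ^ (((k₂ - 1 : ℤ)) : ℝ) * x ^ (-((1 : ℝ) * (((k₂ - 1 : ℤ)) : ℝ))) = 1 := by
        rw [← Real.rpow_add hx0]; ring_nf; exact Real.rpow_zero x
      have hxn0 : 0 ≤ x ^ (-((1 : ℝ) * (((k₂ - 1 : ℤ)) : ℝ))) := (Real.rpow_pos_of_pos hx0 _).le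
      calc T (k₂ - 1) = (x ^ (((k₂ - 1 : ℤ)) : ℝ) * T (k₂ - 1)) * x ^ (-((1 : ℝ) * (((k₂ - 1 : ℤ)) : ℝ))) := by
            rw [mul_comm (x ^ _) (T _), mul_assoc, heq, mul_one]
        _ ≤ (c * E * q ^ ((2 : ℝ) * k₂) * x ^ (k₂ : ℝ) / (x - 1) + x ^ (((k₂ - 1 : ℤ)) : ℝ) * T (k₂ - 1)) *
              x ^ (-((1 : ℝ) * (((k₂ - 1 : ℤ)) : ℝ))) := by
            refine mul_le_mul_of_nonneg_right ?_ hxn0; linarith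
    · have hk' : ¬ (k₂ - 1 ≤ k) := not_le.mpr hlt
      simp only [hB, hk', if_false, hLo, hB₁] at h1
      refine h1.trans ?_
      rw [← hxneg]
      -- (x^{k₂-k} - x)/(x-1) ≤ x^{k₂} x^{-k}/(x-1) and x^{k₂-1-k} = x^{k₂-1} x^{-k}
      have e1 : x ^ (((k₂ - k : ℤ)) : ℝ) = x ^ (k₂ : ℝ) * x ^ (-((1 : ℝ) * k)) := by
        rw [← Real.rpow_add hx0]; push_cast; ring_nf
      have e2 : x ^ (((k₂ - 1 - k : ℤ)) : ℝ) = x ^ (((k₂ - 1 : ℤ)) : ℝ) * x ^ (-((1 : ℝ) * k)) := by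
        rw [← Real.rpow_add hx0]; push_cast; ring_nf
      rw [e1, e2]
      have hxn0 : 0 ≤ x ^ (-((1 : ℝ) * k)) := (Real.rpow_pos_of_pos hx0 _).le
      have hcE : 0 ≤ c * E * q ^ ((2 : ℝ) * k₂) := by
        have := Real.rpow_pos_of_pos hq ((2 : ℝ) * k₂); positivity
      have h3 : c * E * q ^ ((2 : ℝ) * k₂) * (x ^ (k₂ : ℝ) * x ^ (-((1 : ℝ) * k)) - x) / (x - 1) ≤
          c * E * q ^ ((2 : ℝ) * k₂) * x ^ (k₂ : ℝ) / (x - 1) * x ^ (-((1 : ℝ) * k)) := by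
        rw [div_mul_eq_mul_div, div_le_div_iff_of_pos_right hxm]
        nlinarith
      nlinarith [hT0 (k₂ - 1), (Real.rpow_pos_of_pos hx0 (((k₂ - 1 : ℤ)) : ℝ)).le]

/-- **The two-piece envelope satisfies the slack-decay criterion** (hypothesis `SlackDecay` of the (front)
clause): with `q^{11 j} ≤ A' w j` for `j ≥ k₂ − 1` (from (T1), `rpow_le_mul_weight_of_T1`), `q = 1+ε₀ > 1`,
`c, E, K ≥ 0`, `w > 0`, for every `L` the weighted slack `(1 + q^{10k}) √(slackWeight L k)` is bounded in `k`.
[cite: Tao2016AveragedNS, §4 (4.5) with §6.4 Lemma 6.7; cell vocabulary] -/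
theorem two_piece_slackDecay (hε : 0 < ε₀) (hc : 0 ≤ c) (hE : 0 ≤ E) (hK : 0 ≤ K) (hw : ∀ k, 0 < w k)
    (hk₂ : 1 ≤ k₂) {A' : ℝ} (hA' : 0 < A')
    (hJ : ∀ j : ℤ, k₂ - 1 ≤ j → (1 + ε₀) ^ ((11 : ℝ) * j) ≤ A' * w j)
    (hlo : ∀ j : ℤ, j < k₂ → env j = E * (1 + ε₀) ^ ((2 : ℝ) * (k₂ - j)))
    (hhi : ∀ j : ℤ, k₂ ≤ j → env j = K * r ^ 2 / w (j - 1) ^ 2) :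
    ∀ L : ℕ, ∃ C : ℝ, ∀ k : ℤ,
      (1 + (1 + ε₀) ^ ((10 : ℝ) * k)) * Real.sqrt (slackWeight ε₀ θ c env L k) ≤ C := by
  have hq : 0 < 1 + ε₀ := by linarith
  have hq1 : 1 ≤ 1 + ε₀ := by linarith
  set q : ℝ := 1 + ε₀ with hqdef
  have henv0 : ∀ j, 0 ≤ env j := two_piece_env_nonneg hq hE hK hlo hhi
  -- the bound A of the criterion
  set A : ℝ := (1 + q ^ ((10 : ℝ) * k₂)) ^ 2 * (E * q ^ ((2 : ℝ) * k₂)) +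
    4 * q ^ (22 : ℝ) * A' ^ 2 * K * r ^ 2 with hA
  refine slackDecay_of_env_bound (A := A) hε.le hc henv0 fun j => ?_
  by_cases hj : j < k₂
  · -- low shells: (1+q^{10j})² ≤ (1+q^{10k₂})², q^{2j} env j = E q^{2k₂}
    rw [hlo j hj]
    have hjr : (j : ℝ) ≤ k₂ := by exact_mod_cast hj.le
    have h1 : q ^ ((10 : ℝ) * j) ≤ q ^ ((10 : ℝ) * k₂) :=
      Real.rpow_le_rpow_of_exponent_le hq1 (by nlinarith)
    have h10 : 0 ≤ q ^ ((10 : ℝ) * j) := (Real.rpow_pos_of_pos hq _).le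
    have h2 : (1 + q ^ ((10 : ℝ) * j)) ^ 2 ≤ (1 + q ^ ((10 : ℝ) * k₂)) ^ 2 :=
      pow_le_pow_left₀ (by linarith) (by linarith) 2
    have h3 : q ^ ((2 : ℝ) * j) * (E * q ^ ((2 : ℝ) * (k₂ - j))) = E * q ^ ((2 : ℝ) * k₂) := by
      have : q ^ ((2 : ℝ) * j) * q ^ ((2 : ℝ) * (k₂ - j)) = q ^ ((2 : ℝ) * k₂) := by
        rw [← Real.rpow_add hq]; ring_nf
      calc _ = E * (q ^ ((2 : ℝ) * j) * q ^ ((2 : ℝ) * (k₂ - j))) := by ring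
        _ = _ := by rw [this]
    have hEq : 0 ≤ E * q ^ ((2 : ℝ) * k₂) := mul_nonneg hE (Real.rpow_pos_of_pos hq _).le
    have h4 : 0 ≤ 4 * q ^ (22 : ℝ) * A' ^ 2 * K * r ^ 2 := by
      have := Real.rpow_pos_of_pos hq (22 : ℝ); positivity
    calc (1 + q ^ ((10 : ℝ) * j)) ^ 2 * q ^ ((2 : ℝ) * j) * (E * q ^ ((2 : ℝ) * (k₂ - j)))
        = (1 + q ^ ((10 : ℝ) * j)) ^ 2 * (q ^ ((2 : ℝ) * j) * (E * q ^ ((2 : ℝ) * (k₂ - j)))) := by ring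
      _ = (1 + q ^ ((10 : ℝ) * j)) ^ 2 * (E * q ^ ((2 : ℝ) * k₂)) := by rw [h3]
      _ ≤ (1 + q ^ ((10 : ℝ) * k₂)) ^ 2 * (E * q ^ ((2 : ℝ) * k₂)) := mul_le_mul_of_nonneg_right h2 hEq
      _ ≤ A := by simp only [hA]; linarith
  · -- tail shells: (1+q^{10j})² q^{2j} ≤ 4 q^{22 j} = 4 q^{22} (q^{11(j-1)})² ≤ 4 q^{22} A'² w(j-1)²
    push Not at hj
    rw [hhi j hj]
    have hwj := hw (j - 1)
    have hJj := hJ (j - 1) (by linarith)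
    have h10 : 0 ≤ q ^ ((10 : ℝ) * j) := (Real.rpow_pos_of_pos hq _).le
    have hj0 : (0 : ℝ) ≤ j := by exact_mod_cast (show (0 : ℤ) ≤ j by linarith)
    have h1 : (1 : ℝ) ≤ q ^ ((10 : ℝ) * j) := Real.one_le_rpow hq1 (by nlinarith)
    have h2 : (1 + q ^ ((10 : ℝ) * j)) ^ 2 * q ^ ((2 : ℝ) * j) ≤ 4 * q ^ ((22 : ℝ) * j) := by
      have h22 : q ^ ((22 : ℝ) * j) = (q ^ ((10 : ℝ) * j)) ^ 2 * q ^ ((2 : ℝ) * j) := by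
        rw [← Real.rpow_natCast, ← Real.rpow_mul hq.le, ← Real.rpow_add hq]; ring_nf
      rw [h22]
      have h2j : 0 ≤ q ^ ((2 : ℝ) * j) := (Real.rpow_pos_of_pos hq _).le
      have : (1 + q ^ ((10 : ℝ) * j)) ^ 2 ≤ 4 * (q ^ ((10 : ℝ) * j)) ^ 2 := by nlinarith
      nlinarith
    have h3 : q ^ ((22 : ℝ) * j) = q ^ (22 : ℝ) * (q ^ ((11 : ℝ) * (((j - 1 : ℤ)) : ℝ))) ^ 2 := by
      rw [← Real.rpow_natCast, ← Real.rpow_mul hq.le, ← Real.rpow_add hq]; push_cast; ring_nf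
    have h11 : 0 ≤ q ^ ((11 : ℝ) * (((j - 1 : ℤ)) : ℝ)) := (Real.rpow_pos_of_pos hq _).le
    have h4 : (q ^ ((11 : ℝ) * (((j - 1 : ℤ)) : ℝ))) ^ 2 ≤ (A' * w (j - 1)) ^ 2 :=
      pow_le_pow_left₀ h11 hJj 2
    have h22' : 0 ≤ q ^ (22 : ℝ) := (Real.rpow_pos_of_pos hq _).le
    have hKr : 0 ≤ K * r ^ 2 / w (j - 1) ^ 2 := by positivity
    calc (1 + q ^ ((10 : ℝ) * j)) ^ 2 * q ^ ((2 : ℝ) * j) * (K * r ^ 2 / w (j - 1) ^ 2)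
        ≤ 4 * q ^ ((22 : ℝ) * j) * (K * r ^ 2 / w (j - 1) ^ 2) := mul_le_mul_of_nonneg_right h2 hKr
      _ = 4 * q ^ (22 : ℝ) * (q ^ ((11 : ℝ) * (((j - 1 : ℤ)) : ℝ))) ^ 2 * (K * r ^ 2 / w (j - 1) ^ 2) := by
          rw [h3]; ring
      _ ≤ 4 * q ^ (22 : ℝ) * (A' * w (j - 1)) ^ 2 * (K * r ^ 2 / w (j - 1) ^ 2) := by gcongr
      _ = 4 * q ^ (22 : ℝ) * A' ^ 2 * K * r ^ 2 := by field_simp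
      _ ≤ A := by
          simp only [hA]
          have : 0 ≤ (1 + q ^ ((10 : ℝ) * k₂)) ^ 2 * (E * q ^ ((2 : ℝ) * k₂)) := by
            have := Real.rpow_pos_of_pos hq ((2 : ℝ) * k₂); positivity
          linarith

end TwoPiece

end GappedFrontRobust

end Summit.NavierStokesRegularity.NavierStokesRegularity.Theorems

end
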